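import Summits.BirchSwinnertonDyer.BirchSwinnertonDyer.Theorems.PrintX11aUpperNonSurjFiveOfNineFacts
import Summits.BirchSwinnertonDyer.BirchSwinnertonDyer.Theorems.PrintX11aNonSurjMuAnHardFiveIffTwinMuAn
import HarnessLib

/-!
# Route `PrintX11a`, child crux U5 = `PrintX11a.UpperNonSurjFive` (item stmt-BirchSwinnertonDyer-20614): **U5 and its parent BY NAME from
# the K2 route's EXISTING item stmt-BirchSwinnertonDyer-19948 `NonSurjCornerTwinMuAn`, BDMTV and NINE print-exact facts** (cell
# `bsd-print-x11a`, LEAD `bsd-line-x11a-p3` g6 of line «finemu5» r6; `--supports stmt-BirchSwinnertonDyer-20614`)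

HONEST FRAMING.  BSD is not proved by any of this; nothing is asserted about any curve.  Theorems only: no definition, no named fact
minted, no `sorry`; every theorem is CONDITIONAL on its displayed hypotheses and closes nothing by itself.

WHAT.  Six leads of this crux (g0, g2–g6) returned «promote-stub `stub_muAnHardFive`», and LEAD x11a-p1 g1 has just made the bookkeeping
behind that verdict kernel-exact (`Theorems/PrintX11aNonSurjMuAnHardFiveIffTwinMuAn.lean`, p625247): the rung `Theorems.X11aNonSurjMuAnHardFive`
and K2's item 19948 `Theorems.NonSurjCornerTwinMuAn` are ONE open statement (`nonSurjCornerTwinMuAn_of_x11aNonSurjMuAnHardFive` fact-free;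
`x11aNonSurjMuAnHardFive_of_nonSurjCornerTwinMuAn` modulo Balakrishnan–Dogra–Müller–Tuitman–Vonk 2019 Thm. 1.2 `hB`).  This file composes
that identification with g6's nine-fact road (`upperNonSurjFive_of_muAnHardFive_of_nineFacts`, p626443):
* `upperNonSurjFive_of_nonSurjCornerTwinMuAn_of_nineFacts : hB → NonSurjCornerTwinMuAn → ⟨nine facts⟩ → Theses.PrintX11a.UpperNonSurjFive` —
  U5 ⟸ {item 19948, `hB`, the nine print-exact facts of U3 (Stein–Wuthrich 6.1 ×2, Greenberg–Stevens, Kato 12.4, `exists_isNewformOf`,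
  Kato §17.13 V′/VI′/XI′ contra, Mazur Cor. 4.1)}, replacing p3 g0's `x11aNonSurjEulerHalf_five_of_nonSurjCornerTwinMuAn` (p539522: 19948 +
  `hB` + THIRTEEN γ-keyed facts including Gross–Zagier–Kolyvagin, Greenberg 1999 Thm. 1.5 and the Cor-18 fact);
* its `_glue` shape `(NonSurjCornerTwinMuAn ∧ hB ∧ nine-fact conjunction) → UpperNonSurjFive` — what the planner's W-81′ option (b) «ATTACH
  20614 to item 19948» is glued by (option (a) «child = the rung verbatim + input item = the nine conjuncts» is glued by p626443's
  `upperNonSurjFive_of_muAnHardFive_of_nineFacts_glue`); one open statement either way — Greenberg's analytic `μ(ω⁰) = 0` at the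
  non-surjective X11a pairs with `p ∈ {5,7}`;
* the parent `x11aNonSurjEulerHalf_of_nonSurjCornerTwinMuAn_of_nineFacts : hB → NonSurjCornerTwinMuAn → ⟨nine facts⟩ →
  Theses.PrintX11a.X11aNonSurjEulerHalf` (item 20406; the `p = 3` part is U3's μ₃ THEOREM inside `ClassX11a.upperNonSurjThree_body_of_nineFacts`).

beyond-print theorem: NO (composition of landed theorems).  References: [BalakrishnanEtAl2019] §1 Thm. 1.2; [GreenbergLNM1716] §1 Conj. 1.11;
[Kato2004Asterisque] Thm. 12.4, §17.13; [SteinWuthrich2013] Thm. 6.1; [Mazur1978] Cor. 4.1; [Kobayashi2006DocMath] Cor. 4.2; tree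
`Theorems/PrintX11aUpperNonSurjFiveOfNineFacts.lean` (p626443), `Theorems/PrintX11aNonSurjMuAnHardFiveIffTwinMuAn.lean` (p625247),
`Theorems/ErratumRoadFiveNonSurjCornerBranchesDefs.lean` (item 19948's constant).
-/

set_option linter.dupNamespace false
set_option autoImplicit false

noncomputable section

open scoped Classical MatrixGroups ModularForm

open CongruenceSubgroup WeierstrassCurve
  Literature.NumberTheory.EllipticCurves
  Literature.NumberTheory.EllipticCurves.ModularForms
  Literature.NumberTheory.EllipticCurves.Rank1Residual
  Literature.NumberTheory.EllipticCurves.Rank1Residual.Typed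
  Literature.NumberTheory.EllipticCurves.SteinWuthrich2013
  Literature.NumberTheory.EllipticCurves.Kato2004
  Literature.NumberTheory.EllipticCurves.BalakrishnanEtAl2019
  Summit.BirchSwinnertonDyer.Rank1Residual
  Summit.BirchSwinnertonDyer.BirchSwinnertonDyer

namespace Summit.BirchSwinnertonDyer.BirchSwinnertonDyer.Theorems

/-- **Crux U5 BY NAME from item 19948, BDMTV and NINE print-exact named facts** (sorry-free, CONDITIONAL; closes nothing by itself):
x11a-p1 g1's `x11aNonSurjMuAnHardFive_of_nonSurjCornerTwinMuAn` (p625247: item 19948 ⟹ the rung, mod BDMTV) composed with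
`upperNonSurjFive_of_muAnHardFive_of_nineFacts` (p626443).  Compare p3 g0's `x11aNonSurjEulerHalf_five_of_nonSurjCornerTwinMuAn` (p539522:
19948 + `hB` + thirteen γ-keyed facts incl. Gross–Zagier–Kolyvagin, Greenberg 1.5, the Cor-18 fact).
[cite: BalakrishnanEtAl2019, §1 Thm. 1.2 (arXiv:1711.05846 p. 2)] [cite: Kato2004Asterisque, Thm. 12.4 (p. 221) and §17.13 (pp. 279–280)]
[cite: SteinWuthrich2013, Thm. 6.1 (p. 20)] [cite: Mazur1978, Cor. 4.1] [cite: GreenbergLNM1716, §1 Conj. 1.11 (p. 62)] -/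
theorem upperNonSurjFive_of_nonSurjCornerTwinMuAn_of_nineFacts (hB : thm12_not_le_normalizer_splitCartan)
    (hAn : NonSurjCornerTwinMuAn)
    (hJs : thm61_splitMultiplicative) (hJn : thm61_nonsplitMultiplicative)
    (hGS : ∀ (W : WeierstrassCurve ℚ) [W.IsElliptic] [W.IsGloballyMinimal] (p : ℕ) [Fact p.Prime],
      greenberg_stevens (W := W) (p := p))
    (h12 : Kato2004.thm12_4) (hnf : exists_isNewformOf)
    (hns' : Kato2004.exists_multDivisibilityInputs_nonsplit_contra)
    (hsp' : Kato2004.exists_multDivisibilityInputs_split_contra)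
    (hfine' : Kato2004.exists_multDivisibilityInputs_fine_contra) (hMz : mazur_not_dvd_maninConstant_of_odd) :
    Theses.PrintX11a.UpperNonSurjFive :=
  upperNonSurjFive_of_muAnHardFive_of_nineFacts (x11aNonSurjMuAnHardFive_of_nonSurjCornerTwinMuAn hB hAn) hJs hJn hGS h12
    hnf hns' hsp' hfine' hMz

/-- **Glue shape for the ATTACH option**: (item 19948 ∧ BDMTV ∧ the nine-fact conjunction) → `UpperNonSurjFive`.
[cite: BalakrishnanEtAl2019, §1 Thm. 1.2 (arXiv:1711.05846 p. 2)] [cite: GreenbergLNM1716, §1 Conj. 1.11 (p. 62)] -/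
theorem upperNonSurjFive_of_nonSurjCornerTwinMuAn_of_nineFacts_glue :
    (NonSurjCornerTwinMuAn ∧ thm12_not_le_normalizer_splitCartan ∧
      thm61_splitMultiplicative ∧ thm61_nonsplitMultiplicative ∧
      (∀ (W : WeierstrassCurve ℚ) [W.IsElliptic] [W.IsGloballyMinimal] (p : ℕ) [Fact p.Prime],
        greenberg_stevens (W := W) (p := p)) ∧
      Kato2004.thm12_4 ∧ exists_isNewformOf ∧ Kato2004.exists_multDivisibilityInputs_nonsplit_contra ∧
      Kato2004.exists_multDivisibilityInputs_split_contra ∧ Kato2004.exists_multDivisibilityInputs_fine_contra ∧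
      mazur_not_dvd_maninConstant_of_odd) →
    Theses.PrintX11a.UpperNonSurjFive :=
  fun ⟨hAn, hB, hJs, hJn, hGS, h12, hnf, hns', hsp', hfine', hMz⟩ ↦
    upperNonSurjFive_of_nonSurjCornerTwinMuAn_of_nineFacts hB hAn hJs hJn hGS h12 hnf hns' hsp' hfine' hMz

/-- **The parent crux `X11aNonSurjEulerHalf` (item 20406) BY NAME from item 19948, BDMTV and nine facts** — p625247's identification
composed with `x11aNonSurjEulerHalf_of_muAnHardFive_of_nineFacts` (p626443; the `p = 3` part is U3's μ₃ theorem). CONDITIONAL;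
closes nothing. [cite: BalakrishnanEtAl2019, §1 Thm. 1.2 (arXiv:1711.05846 p. 2)] [cite: Kato2004Asterisque, §17.13 (pp. 279–280)]
[cite: GreenbergLNM1716, §1 Conj. 1.11 (p. 62)] -/
theorem x11aNonSurjEulerHalf_of_nonSurjCornerTwinMuAn_of_nineFacts (hB : thm12_not_le_normalizer_splitCartan)
    (hAn : NonSurjCornerTwinMuAn)
    (hJs : thm61_splitMultiplicative) (hJn : thm61_nonsplitMultiplicative)
    (hGS : ∀ (W : WeierstrassCurve ℚ) [W.IsElliptic] [W.IsGloballyMinimal] (p : ℕ) [Fact p.Prime],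
      greenberg_stevens (W := W) (p := p))
    (h12 : Kato2004.thm12_4) (hnf : exists_isNewformOf)
    (hns' : Kato2004.exists_multDivisibilityInputs_nonsplit_contra)
    (hsp' : Kato2004.exists_multDivisibilityInputs_split_contra)
    (hfine' : Kato2004.exists_multDivisibilityInputs_fine_contra) (hMz : mazur_not_dvd_maninConstant_of_odd) :
    Theses.PrintX11a.X11aNonSurjEulerHalf :=
  x11aNonSurjEulerHalf_of_muAnHardFive_of_nineFacts (x11aNonSurjMuAnHardFive_of_nonSurjCornerTwinMuAn hB hAn) hJs hJn hGS h12
    hnf hns' hsp' hfine' hMz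

end Summit.BirchSwinnertonDyer.BirchSwinnertonDyer.Theorems

end
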